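import Literature.GroupTheory.SpecificGroups.ModularGroupFreeProduct
import Literature.GroupTheory.CombinatorialGroupTheory.AmalgamFreeSubgroups
import Literature.NumberTheory.ModularForms.Gamma0FreeModNegOneProofs
import Summits.BirchSwinnertonDyer.BirchSwinnertonDyer.Theorems.ManinLocalTwoThreeGaschuetzAveraging
import Summits.BirchSwinnertonDyer.BirchSwinnertonDyer.Theorems.ManinLocalTwoThreeHeisenbergLiftModP
import HarnessLib

/-!
# THE HEISENBERG LIFT mod `p` FOR EVERY PRIME `p ≥ 5` AT EVERY LEVEL `M`
# (route `ManinLocalTwoThree`, cell bsd-f2-manin; seat `bsd-line-manin23-p2` gen 12; prime-generic shift-equaliser plan, `K_{p,p}` steps)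

BSD is not proved by this file; Manin's conjecture is not proved by this file.  It is a `--supports` helper for the crux items
`ManinOddAtFour` / `ManinPrimeToThreeAtNine` in the shape consumed by p1's `ShiftDescentModP` descent
(`…ShiftDescentModP.exists_heisenbergLift`, which needs `Γ₀(M) = {±1} × free`, i.e. `4 ∣ M` or `9 ∣ M`).

**Main theorem** (`exists_heisenbergLift_of_five_le`, §5): for every prime `p ≥ 5`, every level `M` and all additive maps
`β, λ : Γ₀(M) → ℤ/p` there is `μ : Γ₀(M) → ℤ/p` with `μ(γγ′) = μ γ + μ γ′ + β γ · λ γ′` (the cup product `β ∪ λ` vanishes in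
`H²(Γ₀(M), ℤ/p)` for `p ≥ 5` — no hypothesis on `M`).

Proof.  §1–§2: `SL₂(ℤ)/{±1} ≅ ℤ/2 ∗ ℤ/3` (the tree's `ModularGroupFreeProduct.fromSL`, kernel `{±1}` by
`Gamma0Free.eq_one_or_eq_neg_one_of_fromSL_eq_one`) is identified with Mathlib's `PushoutI` over the trivial group, and every subgroup
of the kernel of the abelianisation `ℤ/2 ∗ ℤ/3 → ℤ/2 × ℤ/3` is free (Bass–Serre / Kurosh in the tree's form
`isFreeGroup_of_disjoint_conjugates'` [cite: SerreTrees, §I.4 Thm 7; §I.5 Thm 8]).  §3: hence `Γ₀(M)` has a subgroup `H` of index `∣ 6`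
(the kernel of `Γ₀(M) → ℤ/2 × ℤ/3`) with homomorphisms `e : F → Γ₀(M)`, `ρ : H → F`, `F` free, and `h = ±e(ρ h)` on `H`.  §4: on a
free group the lift is the `(0,2)` entry of `FreeGroup.lift` into the Heisenberg group `U₃(ℤ/p)` (`ShiftDescentModP.heisU`).  §5: since
`p` is odd, `β(−1) = λ(−1) = 0`, so `ζ ∘ ρ` is a lift on `H`; Gaschütz averaging over the `∣ 6` cosets
(`exists_coboundary_of_coboundary_on_finiteIndex`, invertible because `p ≥ 5`) extends it to `Γ₀(M)` [folklore; cf. Brown,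
*Cohomology of Groups*, III.9–10 (transfer / restriction–corestriction)].
-/

set_option linter.dupNamespace false

noncomputable section

open scoped MatrixGroups
open CongruenceSubgroup Monoid
open Literature.GroupTheory.SpecificGroups.ModularGroupFreeProduct
open Literature.GroupTheory.CombinatorialGroupTheory

namespace Summit.BirchSwinnertonDyer.BirchSwinnertonDyer.Theorems.ManinLocalTwoThree

namespace HeisenbergFiveLe

/-! ### §1 `ℤ/2 ∗ ℤ/3` as Mathlib's `PushoutI` over the trivial group -/

section Bridge

variable (φ : ∀ b : Bool, PUnit.{1} →* Fac b)

/-- Maps out of the one-element group are injective. [folklore] -/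
theorem triv_injective (b : Bool) : Function.Injective (φ b) := fun x y _ => Subsingleton.elim x y

/-- `ofCoprodI : ℤ/2 ∗ ℤ/3 → PushoutI φ` has a two-sided inverse. [folklore] -/
theorem exists_inverse_ofCoprodI :
    ∃ f : PushoutI φ →* FP, f.comp (PushoutI.ofCoprodI (φ := φ)) = MonoidHom.id FP ∧
      (PushoutI.ofCoprodI (φ := φ)).comp f = MonoidHom.id (PushoutI φ) := by
  let f : PushoutI φ →* FP :=
    PushoutI.lift (fun b => (CoprodI.of : Fac b →* FP)) 1 fun b => by
      ext x
      rw [show x = 1 from Subsingleton.elim x 1, map_one, map_one]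
  have hf : ∀ (b : Bool) (g : Fac b), f (PushoutI.of (φ := φ) b g) = CoprodI.of g := fun b g => by simp [f]
  refine ⟨f, ?_, ?_⟩
  · refine CoprodI.ext_hom _ _ fun b => ?_
    ext g
    simp [hf]
  · refine PushoutI.hom_ext (fun b => ?_) ?_
    · ext g
      simp [hf]
    · ext x
      rw [show x = 1 from Subsingleton.elim x 1, map_one, map_one]

/-- `ofCoprodI` is injective. [folklore] -/
theorem ofCoprodI_injective : Function.Injective (PushoutI.ofCoprodI (φ := φ) : FP → PushoutI φ) := by
  obtain ⟨f, hf, -⟩ := exists_inverse_ofCoprodI φ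
  intro x y h
  have := congrArg f h
  rwa [← MonoidHom.comp_apply, ← MonoidHom.comp_apply, hf] at this

/-! ### §2 The abelianisation `ℤ/2 ∗ ℤ/3 → ℤ/2 × ℤ/3`; subgroups of its kernel are free -/

/-- **Subgroups of `ℤ/2 ∗ ℤ/3` killed by the abelianisation are FREE.**  There is a homomorphism
`PushoutI φ → ℤ/2 × ℤ/3` (the abelianisation: the two factors embed as the two coordinates), injective on each factor and
conjugation-invariant, so a subgroup of its kernel meets no conjugate of a factor and the tree's Bass–Serre theorem
`isFreeGroup_of_disjoint_conjugates'` applies. [folklore] -/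
theorem exists_abelianisation :
    ∃ abP : PushoutI φ →* Multiplicative (ZMod 2) × Multiplicative (ZMod 3),
      ∀ S : Subgroup (PushoutI φ), S ≤ abP.ker → IsFreeGroup S := by
  -- the factor embeddings
  let facAb : (b : Bool) → (Fac b →* Multiplicative (ZMod 2) × Multiplicative (ZMod 3)) := fun b =>
    match b with
    | true => MonoidHom.inl _ _
    | false => MonoidHom.inr _ _
  have hinj : ∀ b, Function.Injective (facAb b) := by
    intro b; cases b
    · intro x y h; exact (Prod.ext_iff.mp h).2
    · intro x y h; exact (Prod.ext_iff.mp h).1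
  obtain ⟨f, hf, -⟩ := exists_inverse_ofCoprodI φ
  have hf1 : ∀ (b : Bool) (g : Fac b), f (PushoutI.of (φ := φ) b g) = CoprodI.of g := fun b g => by
    have := congrArg (fun h => h (CoprodI.of g)) hf
    simpa using this
  refine ⟨(CoprodI.lift facAb).comp f, fun S hS => ?_⟩
  refine isFreeGroup_of_disjoint_conjugates' (triv_injective φ) S fun b g γ hmem => ?_
  have h1 : ((CoprodI.lift facAb).comp f) (γ⁻¹ * PushoutI.of (φ := φ) b g * γ) = 1 := hS hmem
  simp only [map_mul, map_inv, MonoidHom.comp_apply, hf1, CoprodI.lift_of, inv_mul_cancel_comm] at h1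
  exact hinj b (by rw [h1, map_one])

end Bridge

/-! ### §3 A free presentation of a subgroup of `Γ₀(M)` of index dividing `6`, modulo `±1` -/

/-- **`Γ₀(M)` has a subgroup `H` of index dividing `6` which is `{±1} × (free)` in the weak form needed**: homomorphisms
`e : F → Γ₀(M)` (`F` free) and `ρ : H → F` with `h = ± e(ρ h)` for every `h ∈ H`.  (`H` = kernel of
`Γ₀(M) → SL₂(ℤ) → PSL₂(ℤ) = ℤ/2 ∗ ℤ/3 → ℤ/2 × ℤ/3`; its image in `ℤ/2 ∗ ℤ/3` is free by §2; `ρ` = that image read in a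
free basis, `e` = a lift of the basis; `ker(SL₂(ℤ) → ℤ/2 ∗ ℤ/3) = {±1}`.) [folklore] -/
theorem exists_kernel_free_presentation (M : ℕ) :
    ∃ (H : Subgroup (Gamma0 M)) (ι : Type) (e : FreeGroup ι →* Gamma0 M) (ρ : H →* FreeGroup ι),
      H.index ∣ 6 ∧
      ∀ h : H, (h : Gamma0 M) = e (ρ h) ∨ (h : Gamma0 M) = ⟨-1, ThreeShiftDescent.negOne_mem_Gamma0⟩ * e (ρ h) := by
  classical
  let φ : ∀ b : Bool, PUnit.{1} →* Fac b := fun _ => 1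
  obtain ⟨abP, hfree⟩ := exists_abelianisation φ
  let π : Gamma0 M →* PushoutI φ := ((PushoutI.ofCoprodI (φ := φ)).comp fromSL).comp (Gamma0 M).subtype
  have hπ : ∀ g : Gamma0 M, π g = PushoutI.ofCoprodI (fromSL (g : SL(2, ℤ))) := fun g => rfl
  let χ : Gamma0 M →* Multiplicative (ZMod 2) × Multiplicative (ZMod 3) := abP.comp π
  let H : Subgroup (Gamma0 M) := χ.ker
  let S : Subgroup (PushoutI φ) := H.map π
  have hS : S ≤ abP.ker := by
    rintro _ ⟨h, hh, rfl⟩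
    exact hh
  haveI : IsFreeGroup S := hfree S hS
  let πS : H →* S := (π.comp H.subtype).codRestrict S fun h => ⟨(h : Gamma0 M), h.2, rfl⟩
  have hπS : ∀ h : H, ((πS h : S) : PushoutI φ) = π (h : Gamma0 M) := fun h => rfl
  have hsurj : Function.Surjective πS := by
    rintro ⟨_, h, hh, rfl⟩
    exact ⟨⟨h, hh⟩, rfl⟩
  choose sec hsec using fun x : IsFreeGroup.Generators S => hsurj (IsFreeGroup.of x)
  let e : FreeGroup (IsFreeGroup.Generators S) →* Gamma0 M := H.subtype.comp (FreeGroup.lift sec)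
  let ρ : H →* FreeGroup (IsFreeGroup.Generators S) := (IsFreeGroup.mulEquiv S).symm.toMonoidHom.comp πS
  have hcomp : ∀ w, πS (FreeGroup.lift sec w) = IsFreeGroup.mulEquiv S w := by
    intro w
    have h : πS.comp (FreeGroup.lift sec) = (IsFreeGroup.mulEquiv S).toMonoidHom := by
      refine FreeGroup.ext_hom _ _ fun x => ?_
      rw [MonoidHom.comp_apply, MulEquiv.coe_toMonoidHom]
      show πS (FreeGroup.lift sec (FreeGroup.of x)) = _
      rw [FreeGroup.lift_apply_of, hsec]
      rfl
    rw [← MonoidHom.comp_apply, h]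
    rfl
  refine ⟨H, _, e, ρ, ?_, fun h => ?_⟩
  · -- index ∣ 6
    show χ.ker.index ∣ 6
    rw [Subgroup.index_ker]
    have h1 := Subgroup.card_subgroup_dvd_card χ.range
    have hA : Nat.card (Multiplicative (ZMod 2) × Multiplicative (ZMod 3)) = 6 := by
      rw [Nat.card_prod]; simp
    rwa [hA] at h1
  · have h1 : πS (FreeGroup.lift sec (ρ h)) = πS h := by
      rw [hcomp]
      exact (IsFreeGroup.mulEquiv S).apply_symm_apply _
    have h2 : π (e (ρ h)) = π (h : Gamma0 M) := by
      have := congrArg (fun s : S => (s : PushoutI φ)) h1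
      exact this
    have h3 : fromSL (((h : Gamma0 M) : SL(2, ℤ)) * (((e (ρ h) : Gamma0 M)) : SL(2, ℤ))⁻¹) = 1 := by
      apply ofCoprodI_injective φ
      rw [map_mul, map_inv, map_one, map_mul, map_inv, ← hπ, ← hπ, h2, mul_inv_cancel]
    rcases Literature.NumberTheory.ModularForms.Gamma0Free.eq_one_or_eq_neg_one_of_fromSL_eq_one h3 with h4 | h4
    · left
      apply Subtype.ext
      exact mul_inv_eq_one.mp h4
    · right
      apply Subtype.ext
      rw [mul_inv_eq_iff_eq_mul] at h4
      simpa using h4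

/-! ### §4 The Heisenberg lift on a free group -/

/-- **Heisenberg lift along a homomorphism from a free group**: for `e : F → G` (`F` free) and additive
`β, λ : G → ℤ/p` there is `ζ : F → ℤ/p` with `ζ(w w′) = ζ w + ζ w′ + β(e w)·λ(e w′)` — the `(0,2)`-entry of
`FreeGroup.lift` into the unitriangular group `U₃(ℤ/p)` (p1's `ShiftDescentModP.heisU`). [folklore] -/
theorem exists_heisenberg_on_free {p : ℕ} {G : Type*} [Group G] {ι : Type*} (e : FreeGroup ι →* G)
    (β lam : G → ZMod p) (hβ : ∀ x y, β (x * y) = β x + β y) (hlam : ∀ x y, lam (x * y) = lam x + lam y) :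
    ∃ ζ : FreeGroup ι → ZMod p, ∀ w w' : FreeGroup ι, ζ (w * w') = ζ w + ζ w' + β (e w) * lam (e w') := by
  let Θ : FreeGroup ι →* SL(3, ZMod p) :=
    FreeGroup.lift fun x => ShiftDescentModP.heisU p (β (e (FreeGroup.of x))) (lam (e (FreeGroup.of x))) 0
  have hβ1 : β 1 = 0 := by have := hβ 1 1; rw [mul_one] at this; linear_combination -this
  have hlam1 : lam 1 = 0 := by have := hlam 1 1; rw [mul_one] at this; linear_combination -this
  have hβinv : ∀ g, β g⁻¹ = -β g := fun g => by
    have := hβ g g⁻¹; rw [mul_inv_cancel, hβ1] at this; linear_combination -this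
  have hlaminv : ∀ g, lam g⁻¹ = -lam g := fun g => by
    have := hlam g g⁻¹; rw [mul_inv_cancel, hlam1] at this; linear_combination -this
  -- normal form of `Θ w`
  have hnf : ∀ w, ∃ z, Θ w = ShiftDescentModP.heisU p (β (e w)) (lam (e w)) z := by
    intro w
    induction w using FreeGroup.induction_on with
    | C1 => exact ⟨0, by rw [map_one, map_one, hβ1, hlam1, ShiftDescentModP.heisU_zero]⟩
    | of x => exact ⟨0, by simp [Θ]⟩
    | inv_of x ih =>
        obtain ⟨z, hz⟩ := ih
        exact ⟨β (e (FreeGroup.of x)) * lam (e (FreeGroup.of x)) - z, by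
          rw [map_inv, hz, ShiftDescentModP.heisU_inv, map_inv, hβinv, hlaminv]⟩
    | mul x y ihx ihy =>
        obtain ⟨z, hz⟩ := ihx
        obtain ⟨z', hz'⟩ := ihy
        exact ⟨z + z' + β (e x) * lam (e y), by
          rw [map_mul, hz, hz', ShiftDescentModP.heisU_mul, map_mul, hβ, hlam]⟩
  refine ⟨fun w => (Θ w) 0 2, fun w w' => ?_⟩
  obtain ⟨z, hz⟩ := hnf w
  obtain ⟨z', hz'⟩ := hnf w'
  show (Θ (w * w')) 0 2 = (Θ w) 0 2 + (Θ w') 0 2 + β (e w) * lam (e w')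
  rw [map_mul, hz, hz', ShiftDescentModP.heisU_mul, ShiftDescentModP.heisU_apply_02, ShiftDescentModP.heisU_apply_02,
    ShiftDescentModP.heisU_apply_02]

/-! ### §5 The Heisenberg lift mod `p ≥ 5` at every level -/

/-- **THE HEISENBERG LIFT mod `p`, EVERY PRIME `p ≥ 5`, EVERY LEVEL `M`.**  For additive `β, λ : Γ₀(M) → ℤ/p` there is
`μ : Γ₀(M) → ℤ/p` with `μ(γγ′) = μ γ + μ γ′ + β γ · λ γ′` — no freeness or divisibility hypothesis on `M`.  Proof: on the
subgroup `H` of §3 (index `∣ 6`) the lift is `ζ ∘ ρ` (§4; `β(±e(ρ h)) = β h` because `β(−1) = 0` for odd `p`), and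
Gaschütz averaging (`exists_coboundary_of_coboundary_on_finiteIndex`) extends it to `Γ₀(M)` since `[Γ₀(M) : H] ∣ 6` is
invertible mod `p ≥ 5`.  This is the input of the `K_{p,p}` descent steps of the prime-generic shift-equaliser programme for
`p ≥ 5` (p1 g11 PLAN; at `p = 3`, `9 ∣ M` and `p = 2`, `4 ∣ M` the tree has the free-presentation lifts
`ShiftDescentModP.exists_heisenbergLift_of_nine_dvd / _of_four_dvd`). [folklore] -/
theorem exists_heisenbergLift_of_five_le {p : ℕ} [Fact p.Prime] (hp5 : 5 ≤ p) {M : ℕ} (β lam : Gamma0 M → ZMod p)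
    (hβ : ∀ x y : Gamma0 M, β (x * y) = β x + β y) (hlam : ∀ x y : Gamma0 M, lam (x * y) = lam x + lam y) :
    ∃ μ : Gamma0 M → ZMod p, ∀ γ γ' : Gamma0 M, μ (γ * γ') = μ γ + μ γ' + β γ * lam γ' := by
  classical
  obtain ⟨H, ι, e, ρ, hidx, hdec⟩ := exists_kernel_free_presentation M
  obtain ⟨ζ, hζ⟩ := exists_heisenberg_on_free e β lam hβ hlam
  have hp2 : p ≠ 2 := by omega
  have h2 : (2 : ZMod p) ≠ 0 := ShiftDescentModP.two_ne_zero_of_odd_prime hp2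
  have hβneg : β ⟨-1, ThreeShiftDescent.negOne_mem_Gamma0⟩ = 0 :=
    ShiftDescentModP.map_negOne_eq_zero_of_two_ne_zero hβ h2
  -- `β(e(ρ h)) = β h`, `λ(e(ρ h)) = λ h` on `H`
  have hβe : ∀ h : H, β (e (ρ h)) = β (h : Gamma0 M) := by
    intro h
    rcases hdec h with h1 | h1
    · rw [← h1]
    · conv_rhs => rw [h1]
      rw [hβ, hβneg, zero_add]
  have hlamneg : lam ⟨-1, ThreeShiftDescent.negOne_mem_Gamma0⟩ = 0 :=
    ShiftDescentModP.map_negOne_eq_zero_of_two_ne_zero hlam h2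
  have hlame : ∀ h : H, lam (e (ρ h)) = lam (h : Gamma0 M) := by
    intro h
    rcases hdec h with h1 | h1
    · rw [← h1]
    · conv_rhs => rw [h1]
      rw [hlam, hlamneg, zero_add]
  -- the lift on `H`
  let μ₀ : Gamma0 M → ZMod p := fun g => if hg : g ∈ H then ζ (ρ ⟨g, hg⟩) else 0
  have hμ₀ : ∀ h ∈ H, ∀ k ∈ H, μ₀ (h * k) = μ₀ h + μ₀ k + β h * lam k := by
    intro h hh k hk
    have hhk : h * k ∈ H := H.mul_mem hh hk
    simp only [μ₀, dif_pos hh, dif_pos hk, dif_pos hhk]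
    have hmul : ρ ⟨h * k, hhk⟩ = ρ ⟨h, hh⟩ * ρ ⟨k, hk⟩ := by rw [← map_mul]; rfl
    rw [hmul, hζ, hβe ⟨h, hh⟩, hlame ⟨k, hk⟩]
  -- finite index, invertible mod `p`
  have hidx0 : H.index ≠ 0 := fun h0 => by rw [h0] at hidx; norm_num at hidx
  haveI : H.FiniteIndex := ⟨hidx0⟩
  have hunit : IsUnit ((H.index : ℕ) : ZMod p) := by
    rw [isUnit_iff_ne_zero, ne_eq, ZMod.natCast_eq_zero_iff]
    intro hpd
    have hp6 : p ∣ 2 * 3 := dvd_trans hpd hidx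
    rcases (Nat.Prime.dvd_mul (Fact.out : p.Prime)).mp hp6 with h | h
    · have := Nat.le_of_dvd (by norm_num) h; omega
    · have := Nat.le_of_dvd (by norm_num) h; omega
  exact exists_coboundary_of_coboundary_on_finiteIndex H hunit (fun x y => β x * lam y)
    (Gaschuetz.twoCocycle_mul hβ hlam) μ₀ hμ₀

end HeisenbergFiveLe

end Summit.BirchSwinnertonDyer.BirchSwinnertonDyer.Theorems.ManinLocalTwoThree

end
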